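import Mathlib

/-!
# Density pinning of the potential on a dense closed shrinker (squeeze lemma for crux stmt-SmoothPoincare4-10870)

For the crux `EntropyRung.CompactShrinkerGap` / STUB 1 of line `cgy-variance-pivot` (the variance budget
`∫(R−2)² dV < 2V − 96π²`): the density hypothesis `Z = ∫e^{-f} dV > Z₀ = 32π²√π e^{-3/2}` together with the
integrated shrinker identity `∫ f e^{-f} dV = 2 ∫ e^{-f} dV` pins the `dV`-DISTRIBUTION of `f` near `2`
quantitatively. Measure-theoretic core (no geometry): with `ε := 1 − e²Z₀/V` one has, for `T ≥ 2`,
`Vol{f ≥ T}·(1 − (T−1)e^{2−T}) ≤ εV` (`volume_superlevel_le`) and, for `T ≤ 2`, `Vol{f ≤ T}·(1 − (T−1)e^{2−T}) ≤ εV`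
(`volume_sublevel_le`). At the Jensen scale `V = 95π²` (`ε = .0157`): `Vol{f ≥ 3} ≤ 5.9 %`, `Vol{f ≥ 4} ≤ 2.6 %`,
`Vol{f ≤ 1} ≤ 1.6 %`, `Vol{f ≤ 3/2} ≤ 8.9 %` of `V`. USE (refuter's squeeze on counterexamples, information for the
provers of STUB 1): a budget violator needs `R_max = f_max > 3.08` (CRZ ceiling) and `dV`-RMS of `R − 2` above `.98`
while `> 85 %` of its volume has `f ∈ (3/2, 3)`; since `R ≤ f`, the variance must come from `R ≪ 2` on the bulk
(Gaussian-shell-like regions, `|∇f|² = f − R ≈ 2`), not from `R > 2`. Companion of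
`Negative/ScalarToolkitAdmitsViolator.lean` (which shows that pinning `f` alone does not pin `R`).
Refuter squeeze lemma (cdisprove gen 4), supports the crux item.
-/

open MeasureTheory Set

namespace Summit.SmoothPoincare4.SmoothPoincare4.Theorems.CompactShrinkerGap.Negative

/-- `t ↦ (t − 1)e^{-t}` is non-increasing on `[T, ∞)` for `T ≥ 2` (so the tangent-line deficit
`ψ(t) = e^{-2} − (t − 1)e^{-t}` is non-decreasing there). [folklore] -/
theorem psi_mono_of_two_le {T t : ℝ} (hT : 2 ≤ T) (ht : T ≤ t) :
    (t - 1) * Real.exp (-t) ≤ (T - 1) * Real.exp (-T) := by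
  -- (t-1)e^{-t} = (T-1 + (t-T)) e^{-T} e^{-(t-T)} ≤ (T-1) e^{-T} iff (T - 1 + u) e^{-u} ≤ T - 1 for u = t - T ≥ 0
  have hu : 0 ≤ t - T := by linarith
  have hE : Real.exp (-t) = Real.exp (-T) * Real.exp (-(t - T)) := by rw [← Real.exp_add]; ring_nf
  rw [hE]
  have h1 : (T - 1 + (t - T)) * Real.exp (-(t - T)) ≤ T - 1 := by
    -- e^{u} ≥ 1 + u ≥ (T-1+u)/(T-1) when T - 1 ≥ 1
    have hexp : t - T + 1 ≤ Real.exp (t - T) := Real.add_one_le_exp _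
    have hpos : 0 < Real.exp (t - T) := Real.exp_pos _
    have hinv : Real.exp (-(t - T)) * Real.exp (t - T) = 1 := by rw [← Real.exp_add]; simp
    have key : (T - 1 + (t - T)) ≤ (T - 1) * Real.exp (t - T) := by nlinarith
    calc (T - 1 + (t - T)) * Real.exp (-(t - T))
        ≤ (T - 1) * Real.exp (t - T) * Real.exp (-(t - T)) :=
          mul_le_mul_of_nonneg_right key (Real.exp_pos _).le
      _ = T - 1 := by rw [mul_assoc, mul_comm (Real.exp (t - T)), hinv, mul_one]
  calc (t - 1) * (Real.exp (-T) * Real.exp (-(t - T)))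
      = Real.exp (-T) * ((T - 1 + (t - T)) * Real.exp (-(t - T))) := by ring
    _ ≤ Real.exp (-T) * (T - 1) := mul_le_mul_of_nonneg_left h1 (Real.exp_pos _).le
    _ = (T - 1) * Real.exp (-T) := by ring

/-- `t ↦ (t − 1)e^{-t}` is non-decreasing on `(-∞, T]` for `T ≤ 2` (so `ψ` is non-increasing there). [folklore] -/
theorem psi_mono_of_le_two {T t : ℝ} (hT : T ≤ 2) (ht : t ≤ T) :
    (t - 1) * Real.exp (-t) ≤ (T - 1) * Real.exp (-T) := by
  -- with u = T - t ≥ 0: (t-1)e^{-t} = (T-1-u)e^{-T}e^{u}; need (T-1-u)e^{u} ≤ T-1, i.e. since T - 1 ≤ 1: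
  have hu : 0 ≤ T - t := by linarith
  have hE : Real.exp (-t) = Real.exp (-T) * Real.exp (T - t) := by rw [← Real.exp_add]; ring_nf
  rw [hE]
  have h1 : (T - 1 - (T - t)) * Real.exp (T - t) ≤ T - 1 := by
    by_cases hneg : T - 1 - (T - t) ≤ 0
    · have : (T - 1 - (T - t)) * Real.exp (T - t) ≤ 0 :=
        mul_nonpos_of_nonpos_of_nonneg hneg (Real.exp_pos _).le
      -- and T - 1 ≥ t - 1 > ... need T - 1 ≥ 0? not nec.; but (t-1) ≤ 0 case: T - 1 ≥ t - 1; if T - 1 < 0 then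
      -- we need LHS ≤ T - 1 < 0: LHS = (t-1) e^{T-t} ≤ (t - 1) ≤ T - 1 since t - 1 ≤ 0 and e^{T-t} ≥ 1
      have ht1 : t - 1 ≤ 0 := by linarith
      have hge : 1 ≤ Real.exp (T - t) := Real.one_le_exp hu
      have : (t - 1) * Real.exp (T - t) ≤ (t - 1) * 1 := mul_le_mul_of_nonpos_left hge ht1
      have h' : T - 1 - (T - t) = t - 1 := by ring
      rw [h']; linarith
    · push Not at hneg
      -- 0 < t - 1 ≤ T - 1 ≤ 1; e^{u} ≤ 1/(1-u) for u < 1: (t-1) e^{T-t} ≤ T - 1 ⟸ e^{u}(T-1-u) ≤ T-1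
      -- use e^{-u} ≥ 1 - u ⇒ e^{u} (1 - u) ≤ 1, and (T-1-u) ≤ (T-1)(1-u) iff u(T-1) ≤ u iff T - 1 ≤ 1 ✓
      have hexp : 1 - (T - t) ≤ Real.exp (-(T - t)) := by
        have := Real.add_one_le_exp (-(T - t)); linarith
      have hinv : Real.exp (-(T - t)) * Real.exp (T - t) = 1 := by rw [← Real.exp_add]; simp
      have hT1 : T - 1 ≤ 1 := by linarith
      have ht1 : 0 < t - 1 := by have h' : T - 1 - (T - t) = t - 1 := by ring
                                 linarith [h' ▸ hneg]
      have hstep : T - 1 - (T - t) ≤ (T - 1) * (1 - (T - t)) := by nlinarith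
      calc (T - 1 - (T - t)) * Real.exp (T - t)
          ≤ (T - 1) * (1 - (T - t)) * Real.exp (T - t) :=
            mul_le_mul_of_nonneg_right hstep (Real.exp_pos _).le
        _ ≤ (T - 1) * Real.exp (-(T - t)) * Real.exp (T - t) := by
            apply mul_le_mul_of_nonneg_right _ (Real.exp_pos _).le
            exact mul_le_mul_of_nonneg_left hexp (by linarith)
        _ = T - 1 := by rw [mul_assoc, hinv, mul_one]
  calc (t - 1) * (Real.exp (-T) * Real.exp (T - t))
      = Real.exp (-T) * ((T - 1 - (T - t)) * Real.exp (T - t)) := by ring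
    _ ≤ Real.exp (-T) * (T - 1) := mul_le_mul_of_nonneg_left h1 (Real.exp_pos _).le
    _ = (T - 1) * Real.exp (-T) := by ring

/-- **Density pinning, superlevel side** (measure-theoretic core). On a finite measure space let `f` be
measurable with `e^{-f}`, `f e^{-f}` integrable, `∫ f e^{-f} = 2∫ e^{-f}` (the integrated identity `Δ_f f = 2 − f`
of a closed normalised 4-d shrinker — prover input, landed as `integral_mul_exp_neg_eq_two_mul`) and
`∫ e^{-f} ≥ (1 − ε) e^{-2} μ(univ)` (the crux's density floor reads this with `ε = 1 − e²Z₀/μ(univ)`,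
`e²Z₀ = 32π²√π e^{1/2} ≈ 93.51π²`). Then for every `T ≥ 2`:
`(1 − (T − 1)e^{2−T}) · μ{f ≥ T} ≤ ε · μ(univ)`. Proof: `ψ(f) = e^{-2} − (f−1)e^{-f} ≥ 0` integrates to
`e^{-2}μ − ∫e^{-f} ≤ εe^{-2}μ` and dominates `ψ(T)·1_{f ≥ T}`. [cite: CaoHamiltonIlmanen2004, §4] -/
theorem volume_superlevel_le {α : Type*} [MeasurableSpace α] (μ : Measure α) [IsFiniteMeasure μ]
    (f : α → ℝ) (hfm : Measurable f)
    (h₁ : Integrable (fun x ↦ Real.exp (-f x)) μ)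
    (h₂ : Integrable (fun x ↦ f x * Real.exp (-f x)) μ)
    (hid : ∫ x, f x * Real.exp (-f x) ∂μ = 2 * ∫ x, Real.exp (-f x) ∂μ)
    {ε : ℝ} (hdens : (1 - ε) * (Real.exp (-2) * (μ univ).toReal) ≤ ∫ x, Real.exp (-f x) ∂μ)
    {T : ℝ} (hT : 2 ≤ T) :
    (1 - (T - 1) * Real.exp (2 - T)) * (μ {x | T ≤ f x}).toReal ≤ ε * (μ univ).toReal := by
  -- ψ(f) := e^{-2} − (f − 1)e^{-f} ≥ 0 has ∫ψ(f) = e^{-2}μ − ∫e^{-f} ≤ ε e^{-2} μ, and ψ(f) ≥ ψ(T) on {f ≥ T}.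
  set S := {x | T ≤ f x} with hS
  have hSm : MeasurableSet S := hfm measurableSet_Ici
  have hψ_nonneg : ∀ t : ℝ, 0 ≤ Real.exp (-2) - (t - 1) * Real.exp (-t) := by
    intro t
    have h1 : t - 2 + 1 ≤ Real.exp (t - 2) := Real.add_one_le_exp (t - 2)
    have h2 : 0 < Real.exp (-t) := Real.exp_pos _
    have : (t - 1) * Real.exp (-t) ≤ Real.exp (-2) := by
      calc (t - 1) * Real.exp (-t) ≤ Real.exp (t - 2) * Real.exp (-t) := by
            apply mul_le_mul_of_nonneg_right _ h2.le; linarith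
        _ = Real.exp (-2) := by rw [← Real.exp_add]; ring_nf
    linarith
  have hψT : ∀ x ∈ S, Real.exp (-2) - (T - 1) * Real.exp (-T) ≤ Real.exp (-2) - (f x - 1) * Real.exp (-f x) := by
    intro x hx
    have := psi_mono_of_two_le hT hx
    linarith
  -- integrability of ψ ∘ f
  have hψint : Integrable (fun x ↦ Real.exp (-2) - (f x - 1) * Real.exp (-f x)) μ := by
    have : (fun x ↦ Real.exp (-2) - (f x - 1) * Real.exp (-f x))
        = fun x ↦ Real.exp (-2) - (f x * Real.exp (-f x) - Real.exp (-f x)) := by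
      funext x; ring
    rw [this]
    have hI : Integrable (fun x ↦ f x * Real.exp (-f x) - Real.exp (-f x)) μ := h₂.sub h₁
    exact (integrable_const _).sub hI
  -- ∫ ψ(f) = e^{-2} μ(univ) - ∫ e^{-f}
  have hψval : ∫ x, (Real.exp (-2) - (f x - 1) * Real.exp (-f x)) ∂μ
      = Real.exp (-2) * (μ univ).toReal - ∫ x, Real.exp (-f x) ∂μ := by
    have : (fun x ↦ Real.exp (-2) - (f x - 1) * Real.exp (-f x))
        = fun x ↦ Real.exp (-2) - (f x * Real.exp (-f x) - Real.exp (-f x)) := by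
      funext x; ring
    have hI : Integrable (fun x ↦ f x * Real.exp (-f x) - Real.exp (-f x)) μ := h₂.sub h₁
    rw [this, integral_sub (integrable_const _) hI, integral_sub h₂ h₁, integral_const, hid,
      smul_eq_mul, Measure.real]
    ring
  -- lower bound: ∫ ψ(f) ≥ ∫_S ψ(f) ≥ ψ(T) μ(S)
  have hlow : (Real.exp (-2) - (T - 1) * Real.exp (-T)) * (μ S).toReal
      ≤ ∫ x, (Real.exp (-2) - (f x - 1) * Real.exp (-f x)) ∂μ := by
    calc (Real.exp (-2) - (T - 1) * Real.exp (-T)) * (μ S).toReal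
        = ∫ x in S, (Real.exp (-2) - (T - 1) * Real.exp (-T)) ∂μ := by
          rw [setIntegral_const, smul_eq_mul, Measure.real]; ring
      _ ≤ ∫ x in S, (Real.exp (-2) - (f x - 1) * Real.exp (-f x)) ∂μ := by
          apply setIntegral_mono_on (integrable_const _).integrableOn hψint.integrableOn hSm
          intro x hx; exact hψT x hx
      _ ≤ ∫ x, (Real.exp (-2) - (f x - 1) * Real.exp (-f x)) ∂μ :=
          setIntegral_le_integral hψint (ae_of_all _ fun x ↦ hψ_nonneg (f x))
  -- combine: ψ(T) μ(S) ≤ e^{-2}μ − ∫e^{-f} ≤ ε e^{-2} μ ; divide by e^{-2}: (1 − (T−1)e^{2−T}) μ(S) ≤ ε μ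
  have hE : Real.exp (-T) = Real.exp (-2) * Real.exp (2 - T) := by rw [← Real.exp_add]; ring_nf
  have hfac : Real.exp (-2) - (T - 1) * Real.exp (-T) = Real.exp (-2) * (1 - (T - 1) * Real.exp (2 - T)) := by
    rw [hE]; ring
  have h2pos : 0 < Real.exp (-2) := Real.exp_pos _
  have hchain : Real.exp (-2) * ((1 - (T - 1) * Real.exp (2 - T)) * (μ S).toReal)
      ≤ Real.exp (-2) * (ε * (μ univ).toReal) := by
    have := hlow
    rw [hfac, hψval] at this
    nlinarith
  exact le_of_mul_le_mul_left hchain h2pos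

/-- **Density pinning, sublevel side**: under the same hypotheses, for every `T ≤ 2`,
`(1 − (T − 1)e^{2−T}) · μ{f ≤ T} ≤ ε · μ(univ)` (e.g. `μ{f ≤ 1} ≤ εμ`, `μ{f ≤ 3/2} ≤ εμ/0.175`).
[cite: CaoHamiltonIlmanen2004, §4] -/
theorem volume_sublevel_le {α : Type*} [MeasurableSpace α] (μ : Measure α) [IsFiniteMeasure μ]
    (f : α → ℝ) (hfm : Measurable f)
    (h₁ : Integrable (fun x ↦ Real.exp (-f x)) μ)
    (h₂ : Integrable (fun x ↦ f x * Real.exp (-f x)) μ)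
    (hid : ∫ x, f x * Real.exp (-f x) ∂μ = 2 * ∫ x, Real.exp (-f x) ∂μ)
    {ε : ℝ} (hdens : (1 - ε) * (Real.exp (-2) * (μ univ).toReal) ≤ ∫ x, Real.exp (-f x) ∂μ)
    {T : ℝ} (hT : T ≤ 2) :
    (1 - (T - 1) * Real.exp (2 - T)) * (μ {x | f x ≤ T}).toReal ≤ ε * (μ univ).toReal := by
  -- ψ(f) := e^{-2} − (f − 1)e^{-f} ≥ 0 has ∫ψ(f) = e^{-2}μ − ∫e^{-f} ≤ ε e^{-2} μ, and ψ(f) ≥ ψ(T) on {f ≥ T}.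
  set S := {x | f x ≤ T} with hS
  have hSm : MeasurableSet S := hfm measurableSet_Iic
  have hψ_nonneg : ∀ t : ℝ, 0 ≤ Real.exp (-2) - (t - 1) * Real.exp (-t) := by
    intro t
    have h1 : t - 2 + 1 ≤ Real.exp (t - 2) := Real.add_one_le_exp (t - 2)
    have h2 : 0 < Real.exp (-t) := Real.exp_pos _
    have : (t - 1) * Real.exp (-t) ≤ Real.exp (-2) := by
      calc (t - 1) * Real.exp (-t) ≤ Real.exp (t - 2) * Real.exp (-t) := by
            apply mul_le_mul_of_nonneg_right _ h2.le; linarith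
        _ = Real.exp (-2) := by rw [← Real.exp_add]; ring_nf
    linarith
  have hψT : ∀ x ∈ S, Real.exp (-2) - (T - 1) * Real.exp (-T) ≤ Real.exp (-2) - (f x - 1) * Real.exp (-f x) := by
    intro x hx
    have := psi_mono_of_le_two hT hx
    linarith
  -- integrability of ψ ∘ f
  have hψint : Integrable (fun x ↦ Real.exp (-2) - (f x - 1) * Real.exp (-f x)) μ := by
    have : (fun x ↦ Real.exp (-2) - (f x - 1) * Real.exp (-f x))
        = fun x ↦ Real.exp (-2) - (f x * Real.exp (-f x) - Real.exp (-f x)) := by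
      funext x; ring
    rw [this]
    have hI : Integrable (fun x ↦ f x * Real.exp (-f x) - Real.exp (-f x)) μ := h₂.sub h₁
    exact (integrable_const _).sub hI
  -- ∫ ψ(f) = e^{-2} μ(univ) - ∫ e^{-f}
  have hψval : ∫ x, (Real.exp (-2) - (f x - 1) * Real.exp (-f x)) ∂μ
      = Real.exp (-2) * (μ univ).toReal - ∫ x, Real.exp (-f x) ∂μ := by
    have : (fun x ↦ Real.exp (-2) - (f x - 1) * Real.exp (-f x))
        = fun x ↦ Real.exp (-2) - (f x * Real.exp (-f x) - Real.exp (-f x)) := by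
      funext x; ring
    have hI : Integrable (fun x ↦ f x * Real.exp (-f x) - Real.exp (-f x)) μ := h₂.sub h₁
    rw [this, integral_sub (integrable_const _) hI, integral_sub h₂ h₁, integral_const, hid,
      smul_eq_mul, Measure.real]
    ring
  -- lower bound: ∫ ψ(f) ≥ ∫_S ψ(f) ≥ ψ(T) μ(S)
  have hlow : (Real.exp (-2) - (T - 1) * Real.exp (-T)) * (μ S).toReal
      ≤ ∫ x, (Real.exp (-2) - (f x - 1) * Real.exp (-f x)) ∂μ := by
    calc (Real.exp (-2) - (T - 1) * Real.exp (-T)) * (μ S).toReal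
        = ∫ x in S, (Real.exp (-2) - (T - 1) * Real.exp (-T)) ∂μ := by
          rw [setIntegral_const, smul_eq_mul, Measure.real]; ring
      _ ≤ ∫ x in S, (Real.exp (-2) - (f x - 1) * Real.exp (-f x)) ∂μ := by
          apply setIntegral_mono_on (integrable_const _).integrableOn hψint.integrableOn hSm
          intro x hx; exact hψT x hx
      _ ≤ ∫ x, (Real.exp (-2) - (f x - 1) * Real.exp (-f x)) ∂μ :=
          setIntegral_le_integral hψint (ae_of_all _ fun x ↦ hψ_nonneg (f x))
  -- combine: ψ(T) μ(S) ≤ e^{-2}μ − ∫e^{-f} ≤ ε e^{-2} μ ; divide by e^{-2}: (1 − (T−1)e^{2−T}) μ(S) ≤ ε μ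
  have hE : Real.exp (-T) = Real.exp (-2) * Real.exp (2 - T) := by rw [← Real.exp_add]; ring_nf
  have hfac : Real.exp (-2) - (T - 1) * Real.exp (-T) = Real.exp (-2) * (1 - (T - 1) * Real.exp (2 - T)) := by
    rw [hE]; ring
  have h2pos : 0 < Real.exp (-2) := Real.exp_pos _
  have hchain : Real.exp (-2) * ((1 - (T - 1) * Real.exp (2 - T)) * (μ S).toReal)
      ≤ Real.exp (-2) * (ε * (μ univ).toReal) := by
    have := hlow
    rw [hfac, hψval] at this
    nlinarith
  exact le_of_mul_le_mul_left hchain h2pos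

end Summit.SmoothPoincare4.SmoothPoincare4.Theorems.CompactShrinkerGap.Negative
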